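import Literature.NumberTheory.EllipticCurves.H1TrivialAction
import HarnessLib

/-!
# Greenberg–Vatsal 2000, §2 display (16) — the devissage of a residual Selmer group along
# `0 → Φ → M → Ψ → 0`, PART 1: the group-cohomological core (exactness and injectivity on `H¹`)

HONEST FRAMING (cell `b2b-bsdres`, run/shared/lean/b2b/bsd-rank1-residual/, verbatim in every
file): the goal of the cell is to DELETE the COMBINATION-SHAPED residual classes of the
Birch–Swinnerton-Dyer formula for ALL analytic-rank `≤ 1` elliptic curves over `ℚ` — "full BSD
formula for every rank `≤ 1` curve in class `C`" assembled STRICTLY from published theorems — so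
that the rank-`≤ 1` remainder becomes exactly the CONSTRUCTION-SHAPED classes, which are TYPED
(missing-input `Prop`s), NOT attempted. This is not "finishing BSD". Sub-cell
`b2b-bsdres-eisenstein-p2` (CLASS-OWNERS row "X2"), gen 16: research route; NO CLAIM BEYOND STATED
CLASSES; nothing here changes a label; no named fact; every declaration is a definition with a
body or a proved theorem. This file is GENERIC continuous group cohomology (no number theory).

WHY. Sub-cell X2a (`r = 0`, odd `p ‖ N`, `E[p]` reducible WITH the Greenberg–Vatsal parity) is
closed in the kernel modulo ONE named fact,
`GreenbergVatsal2000.lambda_muAnal_multiplicative_of_gvPar`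
(`Literature/…/GreenbergVatsal2000/MultiplicativeLambda.lean`), carrying the referee's flag
`GV00-mult-asserted` (R88.2): Greenberg–Vatsal's Thm. (1.3) is PRINTED for good ordinary `p`; its
multiplicative case is asserted by the authors (pp. 1, 3, 14–15) without a numbered statement.
The cell's audit (HOME/b2b-bsdres-eisenstein-p2/X2-GAP.md §2) locates the `E`-dependent content of
that assertion in §2 pp. 28–30, display (16): `λ^alg_{E,Σ₀} = λ_{φ,Σ₀} + λ_{ψ,Σ₀}`, obtained from
`0 → Φ → E[p] → Ψ → 0` (`Φ = C[p]` the ramified-even line, `Ψ` the unramified-odd quotient) by a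
DEVISSAGE of the residual Selmer group `S^{Σ₀}_{E[p]}(ℚ_∞)`. The devissage is proved as a KERNEL
THEOREM in two parts: this file (the exact sequence `H¹(G, Φ) → H¹(G, M) → H¹(G, Ψ)` on the
tree's model of `H¹_cont` — `discreteH1` = Mathlib's `continuousCohomology 1`, explicit cocycles
`contOneCocycles` / `oneCocycleClass`, `resH1Hom`, `cobCocycle`, `contOneCocycles.push/lift` — and
the vanishing `H⁰ = 0` from an element acting as `−1`) and
`X2/ResidualDevissageSelmer.lean` (Greenberg local conditions, the Selmer groups and the count
`#S^{Σ₀}_M(L) = #H¹(ℚ_Σ/L, Φ) · #S^{Σ₀}_Ψ(L)`).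

CONTENT (`G` a topological group; `Φ`, `M`, `Ψ` discrete `G`-modules; equivariant `i : Φ → M`,
`q : M → Ψ`).
* §1 (`i_* = resH1Hom (id_G) i = H¹(id_G, i)`): `pushH1_oneCocycleClass`; `pushH1_pushH1_eq_zero`
  (`q_* ∘ i_* = 0` when `q ∘ i = 0`); **`mem_range_pushH1_of_pushH1_eq_zero`** — exactness of
  `H¹(G, Φ) → H¹(G, M) → H¹(G, Ψ)` for `0 → Φ → M → Ψ → 0` (a cocycle whose image mod `Φ` is a
  coboundary is corrected by a coboundary into a `Φ`-valued cocycle);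
  **`pushH1_injective_of_surjOn_fixed`** — `i_*` is injective when `M^G → Ψ^G` is onto (the
  connecting map `Ψ^G → H¹(G, Φ)` dies on `q(M^G)`); `pushH1_injective_of_bijective` — an
  equivariant isomorphism induces an injection on `H¹` (functoriality).
* §2 `forall_fixed_eq_zero_of_smul_eq_neg`: an element of `H` acting as `−1` on a `p`-torsion
  group, `p` odd ⇒ no nonzero `H`-fixed element (GV p. 29: "`ψ` is odd … `H⁰(ℚ_∞, A_ψ) = 0`" —
  complex conjugation lies in `Gal(ℚ̄/ℚ_∞)`); `surjOn_fixed_of_forall_fixed_eq_zero`.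

References: Greenberg–Vatsal, Invent. Math. 142 (2000) 17–63 = arXiv:math/9906215, §2 pp. 25,
28–30 (display (16)); Serre, *Galois Cohomology* I.§2.2–2.4, I.§5.1; Neukirch–Schmidt–Wingberg
(1.2), I.§5.
-/

noncomputable section

open scoped Classical

universe u

namespace Summit.BirchSwinnertonDyer.Rank1Residual.X2.ResidualDevissage

open Literature.NumberTheory.EllipticCurves Literature.NumberTheory.GaloisRepresentations

/-! ## §1. Generic: `H¹(G, Φ) → H¹(G, M) → H¹(G, Ψ)` for discrete modules -/

section Generic

variable {G : Type u} [Group G] [TopologicalSpace G] [IsTopologicalGroup G]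
variable {Φ : Type u} [AddCommGroup Φ] [DistribMulAction G Φ] [TopologicalSpace Φ]
  [DiscreteTopology Φ]
variable {M : Type u} [AddCommGroup M] [DistribMulAction G M] [TopologicalSpace M]
  [DiscreteTopology M]
variable {Ψ : Type u} [AddCommGroup Ψ] [DistribMulAction G Ψ] [TopologicalSpace Ψ]
  [DiscreteTopology Ψ]

variable {i : Φ →+ M} {hi : ∀ (g : G) (x : Φ), i (ContinuousMonoidHom.id G g • x) = g • i x}
variable {q : M →+ Ψ} {hq : ∀ (g : G) (m : M), q (ContinuousMonoidHom.id G g • m) = g • q m}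

/-- `i_* [f] = [i ∘ f]` on explicit cocycles. [folklore] -/
theorem pushH1_oneCocycleClass (f : contOneCocycles (discreteTopRep G Φ)) :
    resH1Hom (ContinuousMonoidHom.id G) i hi (oneCocycleClass _ f) = oneCocycleClass _ (contOneCocycles.push i hi f) :=
  resH1Hom_id_oneCocycleClass i hi f

/-- **`q_* ∘ i_* = 0`** when `q ∘ i = 0` (the composite cocycle is identically zero).
Serre, *Galois Cohomology* I.§2.2. [folklore] -/
theorem pushH1_pushH1_eq_zero (hqi : ∀ x, q (i x) = 0) (c : discreteH1 G Φ) :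
    resH1Hom (ContinuousMonoidHom.id G) q hq (resH1Hom (ContinuousMonoidHom.id G) i hi c) = 0 := by
  obtain ⟨f, rfl⟩ := classHom_surjective (G := G) (M := Φ) c
  rw [classHom_apply, pushH1_oneCocycleClass, pushH1_oneCocycleClass, oneCocycleClass_eq_zero_iff]
  refine ⟨0, fun g ↦ ?_⟩
  rw [contOneCocycles.push_apply, contOneCocycles.push_apply, hqi, map_zero, sub_zero]

/-- **Exactness of `H¹(G, Φ) → H¹(G, M) → H¹(G, Ψ)` at the middle term** for a short exact
sequence `0 → Φ → M → Ψ → 0` of discrete `G`-modules (`M` with continuous orbit maps): a class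
`[f]` with `q_* [f] = 0` has `q ∘ f = ∂y`, `y = q m`, and `f − ∂m` takes values in
`ker q = im i`. Serre, *Galois Cohomology* I.§2.2 (the long exact sequence); this is the step
"`S_{E[p]} → S_Ψ` has kernel `S_Φ`" of Greenberg–Vatsal's (16).
[cite: GreenbergVatsal2000, §2 pp. 29–30 (display (16))] -/
theorem mem_range_pushH1_of_pushH1_eq_zero (hM : ∀ m : M, Continuous fun g : G ↦ g • m)
    (hinj : Function.Injective i) (hqsurj : Function.Surjective q)
    (hexact : ∀ m, q m = 0 → m ∈ i.range) {c : discreteH1 G M} (hc : resH1Hom (ContinuousMonoidHom.id G) q hq c = 0) :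
    c ∈ (resH1Hom (ContinuousMonoidHom.id G) i hi).range := by
  obtain ⟨f, rfl⟩ := classHom_surjective (G := G) (M := M) c
  rw [classHom_apply, pushH1_oneCocycleClass, oneCocycleClass_eq_zero_iff] at hc
  obtain ⟨y, hy⟩ := hc
  obtain ⟨m, rfl⟩ := hqsurj y
  have hq' : ∀ (g : G) (m : M), q (g • m) = g • q m := hq
  -- `f - ∂m` has values in `ker q`
  have hval : ∀ g, q ((f - cobCocycle m (hM m)).1 g) = 0 := fun g ↦ by
    have h1 : q (f.1 g) = g • q m - q m := hy g
    rw [sub_apply_val, cobCocycle_apply, map_sub, map_sub, h1, hq', sub_self]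
  choose s hs using fun g ↦ (AddMonoidHom.mem_range.1 (hexact _ (hval g)))
  refine ⟨classHom G Φ (contOneCocycles.lift i hi hinj (f - cobCocycle m (hM m)) s hs), ?_⟩
  rw [classHom_apply, pushH1_oneCocycleClass, contOneCocycles.push_lift, classHom_apply,
    oneCocycleClass_sub, oneCocycleClass_cobCocycle, sub_zero]

omit [TopologicalSpace Ψ] [DiscreteTopology Ψ] in
/-- **`i_*` is injective when `M^G → Ψ^G` is surjective** (in particular when `Ψ^G = 0`): the
kernel of `H¹(G, Φ) → H¹(G, M)` is the image of the connecting map `Ψ^G → H¹(G, Φ)`, which dies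
on `q(M^G)`. Serre, *Galois Cohomology* I.§2.2; Greenberg–Vatsal use it with
`H⁰(ℚ_∞, A_ψ) = 0` (p. 29). [cite: GreenbergVatsal2000, §2 p. 29] -/
theorem pushH1_injective_of_surjOn_fixed (hq : ∀ (g : G) (m : M), q (g • m) = g • q m)
    (hinj : Function.Injective i) (hexact : ∀ m, q m = 0 → m ∈ i.range) (hqi : ∀ x, q (i x) = 0)
    (hfix : ∀ y : Ψ, (∀ g : G, g • y = y) → ∃ m : M, (∀ g : G, g • m = m) ∧ q m = y) :
    Function.Injective (resH1Hom (ContinuousMonoidHom.id G) i hi) := by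
  rw [injective_iff_map_eq_zero]
  intro c hc
  obtain ⟨a, rfl⟩ := classHom_surjective (G := G) (M := Φ) c
  rw [classHom_apply, pushH1_oneCocycleClass, oneCocycleClass_eq_zero_iff] at hc
  obtain ⟨m, hm⟩ := hc
  have hi' : ∀ (g : G) (x : Φ), i (g • x) = g • i x := hi
  have hm' : ∀ g : G, i (a.1 g) = g • m - m := hm
  -- `q m` is `G`-fixed
  have hqm : ∀ g : G, g • q m = q m := fun g ↦ by
    rw [← sub_eq_zero, ← hq, ← map_sub, ← hm' g, hqi]
  obtain ⟨m₀, hm₀G, hm₀⟩ := hfix (q m) hqm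
  obtain ⟨x₀, hx₀⟩ := AddMonoidHom.mem_range.1
    (hexact (m - m₀) (by rw [map_sub, hm₀, sub_self]))
  rw [classHom_apply, oneCocycleClass_eq_zero_iff]
  refine ⟨x₀, fun g ↦ hinj ?_⟩
  change i (a.1 g) = i (g • x₀ - x₀)
  rw [map_sub, hi', hx₀, smul_sub, hm₀G g, hm' g]
  abel

omit [IsTopologicalGroup G] in
/-- An equivariant additive ISOMORPHISM `e : M → Ψ` induces an injection `H¹(G, M) → H¹(G, Ψ)`
(its inverse induces a left inverse, by functoriality `resH1Hom_comp` / `resH1Hom_id`).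
Serre, *Galois Cohomology* I.§2.4. [folklore] -/
theorem pushH1_injective_of_bijective [IsTopologicalGroup G] (hbij : Function.Bijective q) :
    Function.Injective (resH1Hom (ContinuousMonoidHom.id G) q hq) := by
  have hq' : ∀ (g : G) (m : M), q (g • m) = g • q m := hq
  let e : M ≃+ Ψ := AddEquiv.ofBijective q hbij
  have he : ∀ (g : G) (y : Ψ),
      e.symm.toAddMonoidHom (ContinuousMonoidHom.id G g • y) = g • e.symm.toAddMonoidHom y := by
    intro g y
    apply hbij.1
    change q (e.symm (g • y)) = q (g • e.symm y)
    rw [hq', show q (e.symm (g • y)) = e (e.symm (g • y)) from rfl, AddEquiv.apply_symm_apply,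
      show q (e.symm y) = e (e.symm y) from rfl, AddEquiv.apply_symm_apply]
  have hcomp : (resH1Hom (ContinuousMonoidHom.id G) e.symm.toAddMonoidHom he).comp (resH1Hom (ContinuousMonoidHom.id G) q hq) = AddMonoidHom.id _ := by
    rw [resH1Hom_comp, ← resH1Hom_id]
    refine resH1Hom_congr rfl ?_ _ _
    ext m
    exact e.symm_apply_apply m
  intro c c' h
  have hc := DFunLike.congr_fun hcomp c
  have hc' := DFunLike.congr_fun hcomp c'
  simp only [AddMonoidHom.comp_apply, AddMonoidHom.id_apply] at hc hc'
  rw [← hc, ← hc', h]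

end Generic

/-! ## §2. `H⁰(ℚ_∞, Ψ) = 0` from an element acting as `−1` (GV p. 29: `ψ` odd) -/

section Odd

variable {H : Type*} [Group H] {Ψ : Type*} [AddCommGroup Ψ] [DistribMulAction H Ψ]

/-- If some `h ∈ H` acts on the `p`-torsion group `Ψ` as `−1` and `p` is odd, then `Ψ^H = 0`:
a fixed `y` has `2y = 0` and `py = 0`, so `y = p•y − k•(2y) = 0` for `p = 2k+1`. GV p. 29:
"noting that the action of `G_ℚ` on `V_p*` is odd, it follows that `H⁰(ℚ_∞, A*) = 0`" — for
`L = ℚ_∞ ⊂ ℝ` complex conjugation lies in `H = Gal(ℚ̄/ℚ_∞)` and acts on the odd line `Ψ` as `−1`.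
[cite: GreenbergVatsal2000, §2 p. 29] -/
theorem forall_fixed_eq_zero_of_smul_eq_neg {p : ℕ} (hp : Odd p) (hΨ : ∀ y : Ψ, p • y = 0)
    {h : H} (hh : ∀ y : Ψ, h • y = -y) (y : Ψ) (hy : ∀ h' : H, h' • y = y) : y = 0 := by
  obtain ⟨k, rfl⟩ := hp
  have h2 : 2 • y = 0 := by
    have := hy h
    rw [hh] at this
    rw [two_nsmul]
    nth_rewrite 1 [← this]
    exact neg_add_cancel y
  have := hΨ y
  rwa [add_nsmul, mul_nsmul', smul_comm (2 : ℕ) k y, h2, smul_zero, zero_add, one_nsmul] at this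

/-- Consequently the hypothesis "`M^H → Ψ^H` is onto" of the devissage holds trivially.
[cite: GreenbergVatsal2000, §2 p. 29] -/
theorem surjOn_fixed_of_forall_fixed_eq_zero {M : Type*} [AddCommGroup M] [DistribMulAction H M]
    (q : M →+ Ψ) (h0 : ∀ y : Ψ, (∀ h : H, h • y = y) → y = 0) (y : Ψ) (hy : ∀ h : H, h • y = y) :
    ∃ m : M, (∀ h : H, h • m = m) ∧ q m = y :=
  ⟨0, fun h ↦ smul_zero h, by rw [map_zero, h0 y hy]⟩

end Odd

end Summit.BirchSwinnertonDyer.Rank1Residual.X2.ResidualDevissage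

end
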